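import Literature.Analysis.PDE.LoewnerNirenbergKelvin
import Mathlib.Analysis.InnerProductSpace.Harmonic.Basic
import HarnessLib

/-!
# The Kelvin transform preserves harmonicity in `ℝ³`: stub `stub_kelvinHarmonicAt` of line
# `registered` (birth, gen 2) for crux `CanonicalBranchRefutation.CanonicalDimensionIsWick`
# (stmt-CriticalPhenomena-15520)

Statement.  In `E = ℝ³` (`EuclideanSpace ℝ (Fin 3)`), let `ι_{c,1}` be the inversion in the unit
sphere centred at `c` (`EuclideanGeometry.inversion c 1`).  If `v` is harmonic at `ι_{c,1} z` and
`z ≠ c`, then the Kelvin transform `K v : y ↦ ‖y - c‖⁻¹ v(ι_{c,1} y)` is harmonic at `z`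
(W. Thomson 1847; in dimension `n` the weight is `‖y - c‖^{2-n}`, here `n = 3`).

Proof.  Harmonicity of `v` holds on a neighbourhood of `ι_{c,1} z`; pulling it back by the
continuous map `ι_{c,1}` (at `z ≠ c`) gives, for `y` near `z`: `y ≠ c`, `v` is `C²` at `ι_{c,1} y`
and `Δv(ι_{c,1} y) = 0`.  Translating the pole to `0` (`ι_{c,1} y = ι_{0,1}(y - c) + c`,
`Δ(G(· - c))(y) = ΔG(y - c)`) and writing the weight as `‖u‖⁻¹ = ((1/‖u‖)²)^{1/2}`, the tree's
Kelvin identity `Literature.Analysis.PDE.LoewnerNirenberg.laplacian_kelvin_zero` (`r = 1`,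
`2k = n - 2 = 1`) gives `Δ(K v)(y) = ((1/‖y - c‖)²)^{5/2} Δv(ι_{c,1} y) = 0`; and `K v` is `C²` at
`z` as the product of `‖· - c‖⁻¹` (smooth off `c`) with `v ∘ ι_{c,1}` (chain rule,
`ContDiffAt.inversion`).  No definitions are introduced.
-/

noncomputable section

open Filter Module EuclideanGeometry InnerProductSpace
open Literature.Analysis.PDE.LoewnerNirenberg
open scoped Topology Laplacian

namespace Summit.CriticalPhenomena.Ising3DConformalLimit.Cruxes.CanonicalDimensionIsWick.Birth

/-- **STUB B (Kelvin).** In `ℝ³` the Kelvin transform `y ↦ ‖y - c‖⁻¹ v(ι_{c,1} y)` of a function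
`v` harmonic at `ι_{c,1} z` is harmonic at `z ≠ c` (`ι_{c,1} = EuclideanGeometry.inversion c 1`):
the Kelvin identity `Δ(K v)(y) = ((1/‖y-c‖)²)^{5/2} (Δv)(ι_{c,1} y)` of
`LoewnerNirenberg.laplacian_kelvin_zero` with `2k = 3 - 2`, after translating the pole to `0`. -/
theorem stub_kelvinHarmonicAt :
    ∀ (v : EuclideanSpace ℝ (Fin 3) → ℝ) (c z : EuclideanSpace ℝ (Fin 3)), z ≠ c →
      InnerProductSpace.HarmonicAt v (EuclideanGeometry.inversion c 1 z) →
      InnerProductSpace.HarmonicAt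
        (fun y => ‖y - c‖⁻¹ * v (EuclideanGeometry.inversion c 1 y)) z := by
  intro v c z hz hv
  -- `2k = n - 2` with `n = 3`, `k = 1/2`
  have hk : 2 * (1 / 2 : ℝ) = (finrank ℝ (EuclideanSpace ℝ (Fin 3)) : ℝ) - 2 := by
    rw [finrank_euclideanSpace_fin]
    norm_num
  -- the transform with the pole translated to `0` and the weight in Kelvin form
  have hF : (fun y => ‖y - c‖⁻¹ * v (inversion c 1 y)) = fun y =>
      (fun u => ((1 / ‖u‖) ^ 2) ^ (1 / 2 : ℝ) *
        v (inversion (0 : EuclideanSpace ℝ (Fin 3)) 1 u + c)) (y - c) := by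
    funext y
    show ‖y - c‖⁻¹ * v (inversion c 1 y) =
      ((1 / ‖y - c‖) ^ 2) ^ (1 / 2 : ℝ) * v (inversion (0 : EuclideanSpace ℝ (Fin 3)) 1 (y - c) + c)
    rw [← Real.sqrt_eq_rpow, Real.sqrt_sq (by positivity), one_div,
      ← inversion_eq_inversion_zero_sub_add]
  -- the inversion is `C²` at `z ≠ c`, and harmonicity of `v` pulls back along it
  have hι : ContDiffAt ℝ 2 (fun y => inversion c 1 y) z :=
    contDiffAt_const.inversion contDiffAt_const contDiffAt_id hz
  have hev : ∀ᶠ y in 𝓝 z, HarmonicAt v (inversion c 1 y) :=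
    hι.continuousAt.tendsto.eventually hv.eventually
  refine ⟨?_, ?_⟩
  · -- `K v` is `C²` at `z`
    have h1 : ContDiffAt ℝ 2 (fun y => ‖y - c‖⁻¹) z :=
      ((contDiffAt_id.sub contDiffAt_const).norm ℝ (sub_ne_zero.2 hz)).inv
        (norm_ne_zero_iff.2 (sub_ne_zero.2 hz))
    exact h1.mul (hv.1.comp z hι)
  · -- `Δ(K v) = 0` near `z`
    filter_upwards [hev, eventually_ne_nhds hz] with y hy hyc
    have hu : y - c ≠ 0 := sub_ne_zero.2 hyc
    have hιy : inversion (0 : EuclideanSpace ℝ (Fin 3)) 1 (y - c) + c = inversion c 1 y :=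
      (inversion_eq_inversion_zero_sub_add c 1 y).symm
    have hvC : ContDiffAt ℝ 2 (fun x => v (x + c))
        (inversion (0 : EuclideanSpace ℝ (Fin 3)) 1 (y - c)) := by
      have h : ContDiffAt ℝ 2 v (inversion (0 : EuclideanSpace ℝ (Fin 3)) 1 (y - c) + c) := by
        rw [hιy]
        exact hy.1
      exact ContDiffAt.comp (f := fun x => x + c) _ h (contDiffAt_id.add contDiffAt_const)
    have h0 : (Δ v) (inversion c 1 y) = 0 := hy.2.eq_of_nhds
    rw [hF, laplacian_translate_sub (fun u => ((1 / ‖u‖) ^ 2) ^ (1 / 2 : ℝ) *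
        v (inversion (0 : EuclideanSpace ℝ (Fin 3)) 1 u + c)) c y,
      laplacian_kelvin_zero one_pos hk hu hvC, laplacian_translate_add v c, hιy, h0, mul_zero]
    rfl

end Summit.CriticalPhenomena.Ising3DConformalLimit.Cruxes.CanonicalDimensionIsWick.Birth

end
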